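import Summits.NavierStokesRegularity.NavierStokesRegularity.Theorems.OddMorawetzMorawetzKillsTypeIJetCoordDefs
import Summits.NavierStokesRegularity.NavierStokesRegularity.Theorems.OddMorawetzMorawetzKillsTypeISignedPermBasis
import Summits.NavierStokesRegularity.NavierStokesRegularity.Theorems.OddMorawetzMorawetzKillsTypeICubicJetExpansion

/-!
# Crux `OddMorawetz.MorawetzKillsTypeI` — stub `stub_kitSign` (the hyperoctahedral SIGN rule)

Item `stmt-NavierStokesRegularity-1377`, line `registered`.  Let `T` be a continuous trilinear form on 3-jets
(value, first, second and third derivative) which is invariant under the simultaneous jet action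
`jetAct g` of every linear isometry `g` of `ℝ³`, and suppose the symmetrised basis multilinear maps `jbsum n c J`
transform under a signed coordinate permutation `(σ, ε)` by
`mlAct (signedPerm σ ε) n (jbsum n c J) = (ε(σ c) ∏ₛ ε(σ (J s))) • jbsum n (σ c) (σ ∘ J)` (hypothesis `hS`,
the neighbouring stub `stub_symBasis`).  Then a coefficient `T(X, Y, W)` on PURE basis jets — `(e_a, 0, 0, 0)`,
`(0, jbsum 1 c J, 0, 0)`, `(0, 0, jbsum 2 c J, 0)`, `(0, 0, 0, jbsum 3 c J)` — vanishes as soon as some index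
value `v ∈ {0, 1, 2}` occurs an ODD number of times among all the indices of `X, Y, W`.

Proof: take the sign flip `g = signedPerm 1 ε`, `ε = (1, …, -1 at v, …, 1)` (`x_v ↦ -x_v`).  Each pure basis jet
is an eigenvector of `jetAct g`, with eigenvalue the product of `ε` over its indices; by invariance and
multilinearity `T(X, Y, W) = (∏ over all indices i of ε i) · T(X, Y, W) = (-1) ^ (count of v) · T(X, Y, W)
= -T(X, Y, W)`.  Six blocks are registered: `u u T`, `u A H`, `A A A` (weight 3) and `u H T`, `A A T`, `A H H`
(weight 5).  Mathlib + the landed `jetAct_apply`, `signedPerm_single`, `CubicJetExpansion.smul_zero_cmm`.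
-/

noncomputable section

set_option linter.dupNamespace false

namespace Summit.NavierStokesRegularity.NavierStokesRegularity.Theorems

open Summit.NavierStokesRegularity.NavierStokesRegularity.Theorems.OddMorawetz

namespace KitSign

/-! ### Generic pieces -/

/-- **Eigen-sign argument.** If the three arguments of an invariant trilinear form are eigenvectors of
`jetAct g` whose eigenvalues multiply to `-1`, the coefficient vanishes. -/
theorem tri_eq_zero_of_eigen (T : Jet3 [×3]→L[ℝ] ℝ) (g : E3 ≃ₗᵢ[ℝ] E3)
    (hT : ∀ x : Fin 3 → Jet3, T (fun s => jetAct g (x s)) = T x)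
    (P₁ P₂ P₃ : Jet3) (c₁ c₂ c₃ : ℝ) (h₁ : jetAct g P₁ = c₁ • P₁) (h₂ : jetAct g P₂ = c₂ • P₂)
    (h₃ : jetAct g P₃ = c₃ • P₃) (hc : c₁ * c₂ * c₃ = -1) : T ![P₁, P₂, P₃] = 0 := by
  have e : (fun s => jetAct g (![P₁, P₂, P₃] s)) = fun s => ![c₁, c₂, c₃] s • ![P₁, P₂, P₃] s := by
    funext s
    fin_cases s
    · simpa using h₁
    · simpa using h₂
    · simpa using h₃
  have h2 : T ![P₁, P₂, P₃] = (c₁ * c₂ * c₃) * T ![P₁, P₂, P₃] := by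
    calc T ![P₁, P₂, P₃] = T (fun s => jetAct g (![P₁, P₂, P₃] s)) := (hT _).symm
      _ = T (fun s => ![c₁, c₂, c₃] s • ![P₁, P₂, P₃] s) := by rw [e]
      _ = (∏ s, ![c₁, c₂, c₃] s) • T ![P₁, P₂, P₃] := T.map_smul_univ _ _
      _ = (c₁ * c₂ * c₃) * T ![P₁, P₂, P₃] := by
        rw [Fin.prod_univ_three, smul_eq_mul]
        simp only [Matrix.cons_val_zero, Matrix.cons_val_one, Matrix.cons_val_two, Matrix.head_cons,
          Matrix.tail_cons]
  rw [hc] at h2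
  linarith

/-- A pure value jet `(x, 0, 0, 0)` with `g x = k • x` is an eigenvector of `jetAct g`. -/
theorem jetAct_pure₀ (g : E3 ≃ₗᵢ[ℝ] E3) (x : E3) (k : ℝ) (h : g x = k • x) :
    jetAct g ((x, 0, 0, 0) : Jet3) = k • ((x, 0, 0, 0) : Jet3) := by
  rw [jetAct_apply]
  simp only [map_zero, h, Prod.smul_mk, CubicJetExpansion.smul_zero_cmm]

/-- A pure first-order jet `(0, X, 0, 0)` with `mlAct g 1 X = k • X` is an eigenvector of `jetAct g`. -/
theorem jetAct_pure₁ (g : E3 ≃ₗᵢ[ℝ] E3) (X : E3 [×1]→L[ℝ] E3) (k : ℝ) (h : mlAct g 1 X = k • X) :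
    jetAct g ((0, X, 0, 0) : Jet3) = k • ((0, X, 0, 0) : Jet3) := by
  rw [jetAct_apply]
  simp only [map_zero, h, Prod.smul_mk, smul_zero, CubicJetExpansion.smul_zero_cmm]

/-- A pure second-order jet `(0, 0, X, 0)` with `mlAct g 2 X = k • X` is an eigenvector of `jetAct g`. -/
theorem jetAct_pure₂ (g : E3 ≃ₗᵢ[ℝ] E3) (X : E3 [×2]→L[ℝ] E3) (k : ℝ) (h : mlAct g 2 X = k • X) :
    jetAct g ((0, 0, X, 0) : Jet3) = k • ((0, 0, X, 0) : Jet3) := by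
  rw [jetAct_apply]
  simp only [map_zero, h, Prod.smul_mk, smul_zero, CubicJetExpansion.smul_zero_cmm]

/-- A pure third-order jet `(0, 0, 0, X)` with `mlAct g 3 X = k • X` is an eigenvector of `jetAct g`. -/
theorem jetAct_pure₃ (g : E3 ≃ₗᵢ[ℝ] E3) (X : E3 [×3]→L[ℝ] E3) (k : ℝ) (h : mlAct g 3 X = k • X) :
    jetAct g ((0, 0, 0, X) : Jet3) = k • ((0, 0, 0, X) : Jet3) := by
  rw [jetAct_apply]
  simp only [map_zero, h, Prod.smul_mk, smul_zero, CubicJetExpansion.smul_zero_cmm]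

/-! ### The sign flip `x_v ↦ -x_v` and the parity count -/

/-- The product of the signs `ε = (1, …, -1 at v, …, 1)` over a list of indices is `(-1) ^ (count of v)`. -/
theorem prod_map_update (v : Fin 3) (l : List (Fin 3)) :
    (l.map fun i => (((Function.update (1 : Fin 3 → ℤˣ) v (-1) i : ℤˣ) : ℤ) : ℝ)).prod = (-1) ^ l.count v := by
  induction l with
  | nil => simp
  | cons b l ih =>
    rw [List.map_cons, List.prod_cons, ih, List.count_cons, pow_add]
    by_cases hb : b = v
    · subst hb
      simp [mul_comm]
    · simp [hb]

/-- A product over `Fin n` as the product over the list `List.ofFn`. -/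
theorem prod_map_ofFn (w : Fin 3 → ℝ) {n : ℕ} (J : Fin n → Fin 3) :
    ((List.ofFn J).map w).prod = ∏ s, w (J s) := by
  rw [List.map_ofFn, Fin.prod_ofFn]
  rfl

end KitSign

/-! ### The registered statement -/

/-- **stub `stub_kitSign` of the crux `OddMorawetz.MorawetzKillsTypeI` (line `registered`): the hyperoctahedral
SIGN rule.** For an isometry-invariant continuous trilinear form `T` on 3-jets and the symmetrised basis maps
`jbsum` (transforming under signed permutations as in the hypothesis `hS`), a coefficient `T(X, Y, W)` on pure
basis jets vanishes as soon as some index value `v ∈ {0, 1, 2}` occurs an odd number of times among all the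
indices: blocks `u u T`, `u A H`, `A A A` (weight 3) and `u H T`, `A A T`, `A H H` (weight 5).  (Flip the sign of
`e_v`: every pure basis jet is an eigenvector, and the product of the eigenvalues is `(-1) ^ (count of v) = -1`.) -/
theorem stub_kitSign :
    let e : Fin 3 → E3 := fun i => EuclideanSpace.single i (1 : ℝ);
    ∀ (T : Jet3 [×3]→L[ℝ] ℝ),
      (∀ (g : E3 ≃ₗᵢ[ℝ] E3) (x : Fin 3 → Jet3), T (fun s => jetAct g (x s)) = T x) →
      (∀ (σ : Equiv.Perm (Fin 3)) (ε : Fin 3 → ℤˣ) (n : ℕ) (c : Fin 3) (J : Fin n → Fin 3),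
        mlAct (signedPerm σ ε) n (jbsum n c J) =
          (((ε (σ c) : ℤ) : ℝ) * ∏ s, ((ε (σ (J s)) : ℤ) : ℝ)) • jbsum n (σ c) (σ ∘ J)) →
      (∀ (a a' c : Fin 3) (J : Fin 3 → Fin 3), (∃ v : Fin 3, Odd ((a :: a' :: c :: List.ofFn J).count v)) →
        T ![((e a, 0, 0, 0) : Jet3), ((e a', 0, 0, 0) : Jet3), ((0, 0, 0, jbsum 3 c J) : Jet3)] = 0) ∧
      (∀ (a c₁ : Fin 3) (J₁ : Fin 1 → Fin 3) (c₂ : Fin 3) (J₂ : Fin 2 → Fin 3),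
        (∃ v : Fin 3, Odd ((a :: c₁ :: c₂ :: (List.ofFn J₁ ++ List.ofFn J₂)).count v)) →
        T ![((e a, 0, 0, 0) : Jet3), ((0, jbsum 1 c₁ J₁, 0, 0) : Jet3), ((0, 0, jbsum 2 c₂ J₂, 0) : Jet3)] = 0) ∧
      (∀ (c₁ : Fin 3) (J₁ : Fin 1 → Fin 3) (c₂ : Fin 3) (J₂ : Fin 1 → Fin 3) (c₃ : Fin 3) (J₃ : Fin 1 → Fin 3),
        (∃ v : Fin 3, Odd ((c₁ :: c₂ :: c₃ :: (List.ofFn J₁ ++ List.ofFn J₂ ++ List.ofFn J₃)).count v)) →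
        T ![((0, jbsum 1 c₁ J₁, 0, 0) : Jet3), ((0, jbsum 1 c₂ J₂, 0, 0) : Jet3), ((0, jbsum 1 c₃ J₃, 0, 0) : Jet3)] = 0) ∧
      (∀ (a c₂ : Fin 3) (J₂ : Fin 2 → Fin 3) (c₃ : Fin 3) (J₃ : Fin 3 → Fin 3),
        (∃ v : Fin 3, Odd ((a :: c₂ :: c₃ :: (List.ofFn J₂ ++ List.ofFn J₃)).count v)) →
        T ![((e a, 0, 0, 0) : Jet3), ((0, 0, jbsum 2 c₂ J₂, 0) : Jet3), ((0, 0, 0, jbsum 3 c₃ J₃) : Jet3)] = 0) ∧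
      (∀ (c₁ : Fin 3) (J₁ : Fin 1 → Fin 3) (c₂ : Fin 3) (J₂ : Fin 1 → Fin 3) (c₃ : Fin 3) (J₃ : Fin 3 → Fin 3),
        (∃ v : Fin 3, Odd ((c₁ :: c₂ :: c₃ :: (List.ofFn J₁ ++ List.ofFn J₂ ++ List.ofFn J₃)).count v)) →
        T ![((0, jbsum 1 c₁ J₁, 0, 0) : Jet3), ((0, jbsum 1 c₂ J₂, 0, 0) : Jet3), ((0, 0, 0, jbsum 3 c₃ J₃) : Jet3)] = 0) ∧
      (∀ (c₁ : Fin 3) (J₁ : Fin 1 → Fin 3) (c₂ : Fin 3) (J₂ : Fin 2 → Fin 3) (c₃ : Fin 3) (J₃ : Fin 2 → Fin 3),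
        (∃ v : Fin 3, Odd ((c₁ :: c₂ :: c₃ :: (List.ofFn J₁ ++ List.ofFn J₂ ++ List.ofFn J₃)).count v)) →
        T ![((0, jbsum 1 c₁ J₁, 0, 0) : Jet3), ((0, 0, jbsum 2 c₂ J₂, 0) : Jet3), ((0, 0, jbsum 2 c₃ J₃, 0) : Jet3)] = 0) := by
  dsimp only
  intro T hT hS
  -- eigen-relations of the pure basis jets under the sign flips `signedPerm 1 ε`
  have hU : ∀ (ε : Fin 3 → ℤˣ) (a : Fin 3),
      jetAct (signedPerm 1 ε) ((EuclideanSpace.single a (1 : ℝ), 0, 0, 0) : Jet3) =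
        ((ε a : ℤ) : ℝ) • ((EuclideanSpace.single a (1 : ℝ), 0, 0, 0) : Jet3) := by
    intro ε a
    refine KitSign.jetAct_pure₀ _ _ _ ?_
    simpa only [Equiv.Perm.coe_one, id_eq] using signedPerm_single 1 ε a
  have hS1 : ∀ (ε : Fin 3 → ℤˣ) (n : ℕ) (c : Fin 3) (J : Fin n → Fin 3),
      mlAct (signedPerm 1 ε) n (jbsum n c J) = (((ε c : ℤ) : ℝ) * ∏ s, ((ε (J s) : ℤ) : ℝ)) • jbsum n c J := by
    intro ε n c J
    simpa only [Equiv.Perm.coe_one, id_eq, Function.id_comp] using hS 1 ε n c J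
  refine ⟨?_, ?_, ?_, ?_, ?_, ?_⟩
  · rintro a a' c J ⟨v, hv⟩
    have hodd := KitSign.prod_map_update v (a :: a' :: c :: List.ofFn J)
    rw [Odd.neg_one_pow hv] at hodd
    simp only [List.map_cons, List.prod_cons, KitSign.prod_map_ofFn] at hodd
    exact KitSign.tri_eq_zero_of_eigen T _ (hT _) _ _ _ _ _ _ (hU (Function.update 1 v (-1)) a) (hU _ a')
      (KitSign.jetAct_pure₃ _ _ _ (hS1 _ 3 c J)) (by linear_combination hodd)
  · rintro a c₁ J₁ c₂ J₂ ⟨v, hv⟩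
    have hodd := KitSign.prod_map_update v (a :: c₁ :: c₂ :: (List.ofFn J₁ ++ List.ofFn J₂))
    rw [Odd.neg_one_pow hv] at hodd
    simp only [List.map_cons, List.prod_cons, List.map_append, List.prod_append,
      KitSign.prod_map_ofFn] at hodd
    exact KitSign.tri_eq_zero_of_eigen T _ (hT _) _ _ _ _ _ _ (hU (Function.update 1 v (-1)) a)
      (KitSign.jetAct_pure₁ _ _ _ (hS1 _ 1 c₁ J₁)) (KitSign.jetAct_pure₂ _ _ _ (hS1 _ 2 c₂ J₂))
      (by linear_combination hodd)
  · rintro c₁ J₁ c₂ J₂ c₃ J₃ ⟨v, hv⟩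
    have hodd := KitSign.prod_map_update v (c₁ :: c₂ :: c₃ :: (List.ofFn J₁ ++ List.ofFn J₂ ++ List.ofFn J₃))
    rw [Odd.neg_one_pow hv] at hodd
    simp only [List.map_cons, List.prod_cons, List.map_append, List.prod_append,
      KitSign.prod_map_ofFn] at hodd
    exact KitSign.tri_eq_zero_of_eigen T _ (hT _) _ _ _ _ _ _
      (KitSign.jetAct_pure₁ _ _ _ (hS1 (Function.update 1 v (-1)) 1 c₁ J₁))
      (KitSign.jetAct_pure₁ _ _ _ (hS1 _ 1 c₂ J₂)) (KitSign.jetAct_pure₁ _ _ _ (hS1 _ 1 c₃ J₃))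
      (by linear_combination hodd)
  · rintro a c₂ J₂ c₃ J₃ ⟨v, hv⟩
    have hodd := KitSign.prod_map_update v (a :: c₂ :: c₃ :: (List.ofFn J₂ ++ List.ofFn J₃))
    rw [Odd.neg_one_pow hv] at hodd
    simp only [List.map_cons, List.prod_cons, List.map_append, List.prod_append,
      KitSign.prod_map_ofFn] at hodd
    exact KitSign.tri_eq_zero_of_eigen T _ (hT _) _ _ _ _ _ _ (hU (Function.update 1 v (-1)) a)
      (KitSign.jetAct_pure₂ _ _ _ (hS1 _ 2 c₂ J₂)) (KitSign.jetAct_pure₃ _ _ _ (hS1 _ 3 c₃ J₃))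
      (by linear_combination hodd)
  · rintro c₁ J₁ c₂ J₂ c₃ J₃ ⟨v, hv⟩
    have hodd := KitSign.prod_map_update v (c₁ :: c₂ :: c₃ :: (List.ofFn J₁ ++ List.ofFn J₂ ++ List.ofFn J₃))
    rw [Odd.neg_one_pow hv] at hodd
    simp only [List.map_cons, List.prod_cons, List.map_append, List.prod_append,
      KitSign.prod_map_ofFn] at hodd
    exact KitSign.tri_eq_zero_of_eigen T _ (hT _) _ _ _ _ _ _
      (KitSign.jetAct_pure₁ _ _ _ (hS1 (Function.update 1 v (-1)) 1 c₁ J₁))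
      (KitSign.jetAct_pure₁ _ _ _ (hS1 _ 1 c₂ J₂)) (KitSign.jetAct_pure₃ _ _ _ (hS1 _ 3 c₃ J₃))
      (by linear_combination hodd)
  · rintro c₁ J₁ c₂ J₂ c₃ J₃ ⟨v, hv⟩
    have hodd := KitSign.prod_map_update v (c₁ :: c₂ :: c₃ :: (List.ofFn J₁ ++ List.ofFn J₂ ++ List.ofFn J₃))
    rw [Odd.neg_one_pow hv] at hodd
    simp only [List.map_cons, List.prod_cons, List.map_append, List.prod_append,
      KitSign.prod_map_ofFn] at hodd
    exact KitSign.tri_eq_zero_of_eigen T _ (hT _) _ _ _ _ _ _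
      (KitSign.jetAct_pure₁ _ _ _ (hS1 (Function.update 1 v (-1)) 1 c₁ J₁))
      (KitSign.jetAct_pure₂ _ _ _ (hS1 _ 2 c₂ J₂)) (KitSign.jetAct_pure₂ _ _ _ (hS1 _ 2 c₃ J₃))
      (by linear_combination hodd)

end Summit.NavierStokesRegularity.NavierStokesRegularity.Theorems
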